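import Summits.Parity.GeneralizedHardyLittlewood.Theorems.BeyondDiagonalBeatsQuarter.CornerWeight
import HarnessLib

/-!
# Route `PrimeLevelFamEdge`, crux K_B (stmt-Parity-20343), line `diagonal_kernel_split`, helper H1
# (`CornerNegligibleXSq`), part 2: the corner weight `E(y) = 𝒲(y) + ½ log y` — integral formula and size

Continuation of `CornerWeight.lean` (definitions `rFun`, `scriptW`, `cornerE` and the kernels
`b₁ = 1/(e^{v+y/v} − 1)`, `b₂ = v/(v²+y) − v/(v²+1)` there). Here:
* `integral_F3_deriv`: `∫_0^∞ [r(v) + v/(v²+1)] dv = 0` (antiderivative `log(1 − e^{−v}) − log v + ½ log(v²+1)`,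
  continuous at `0⁺` with value `0`, limit `0` at `∞`) — the constant term of the corner weight vanishes;
* `cornerE_eq_integral`: **`E(y) = ∫_0^∞ [r(v + y/v) − r(v)] dv`** (`y > 0`);
* `cornerE_nonneg`, `cornerE_mono`, **`cornerE_le_sqrt`** (`0 ≤ E(y) ≤ √y`, `E` increasing: split at `v = √y`
  and compare the tail with the shift `∫_s^∞ [r(v+s) − r(v)] dv = −∫_s^{2s} r ≤ s/2`), `cornerE_le_log`
  (`E(y) ≤ 𝒲(1) + ½ log y` for `y ≥ 1`).
Pure real analysis over Mathlib; nothing about L-functions is asserted. «The programme SEARCHES and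
TYPES; no claim about Landau–Siegel zeros, Theorems 1–2 of arXiv:2211.02515 or a repaired Margin232
until a kernel theorem says so.»
-/

noncomputable section

open Real Set MeasureTheory Filter Topology

namespace Summit.Parity.GeneralizedHardyLittlewood.Theorems.BeyondDiagonalBeatsQuarter.Corner

/-- The third kernel `b₃(v) = r(v) + v/(v²+1)` is the derivative of
`F₃(v) = log(1 − e^{−v}) − log v + ½ log(v²+1)` on `(0, ∞)`. [folklore] -/
theorem hasDerivAt_F3 {v : ℝ} (hv : 0 < v) :
    HasDerivAt (fun v : ℝ ↦ Real.log (1 - Real.exp (-v)) - Real.log v + Real.log (v ^ 2 + 1) / 2)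
      (rFun v + v / (v ^ 2 + 1)) v := by
  have hex : 0 < 1 - Real.exp (-v) := by
    have : Real.exp (-v) < 1 := Real.exp_lt_one_iff.2 (by linarith)
    linarith
  have h0 : HasDerivAt (fun v : ℝ ↦ Real.exp (-v)) (Real.exp (-v) * (-1)) v :=
    (Real.hasDerivAt_exp (-v)).comp v ((hasDerivAt_id v).neg)
  have h1 : HasDerivAt (fun v : ℝ ↦ Real.log (1 - Real.exp (-v)))
      ((0 - Real.exp (-v) * (-1)) / (1 - Real.exp (-v))) v :=
    ((hasDerivAt_const v (1 : ℝ)).sub h0).log hex.ne'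
  have h2 : HasDerivAt (fun v : ℝ ↦ Real.log v) v⁻¹ v := Real.hasDerivAt_log hv.ne'
  have hsq : HasDerivAt (fun v : ℝ ↦ v ^ 2) (2 * v) v := by simpa using hasDerivAt_pow 2 v
  have h1' : (v : ℝ) ^ 2 + 1 ≠ 0 := by positivity
  have h3 : HasDerivAt (fun v : ℝ ↦ Real.log (v ^ 2 + 1) / 2) ((2 * v + 0) / (v ^ 2 + 1) / 2) v :=
    ((hsq.add (hasDerivAt_const v (1 : ℝ))).log h1').div_const 2
  have h4 := (h1.sub h2).add h3
  refine h4.congr_deriv ?_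
  -- e^{-v}/(1 − e^{-v}) = 1/(eᵛ − 1)
  have hexv : Real.exp (-v) = (Real.exp v)⁻¹ := Real.exp_neg v
  have hpos : 0 < Real.exp v - 1 := (sub_pos.2 (Real.one_lt_exp_iff.2 hv))
  unfold rFun
  rw [hexv]
  have hne : (Real.exp v) ≠ 0 := (Real.exp_pos v).ne'
  field_simp
  ring

/-- `(1 − e^{−t})/t → 1` as `t → 0⁺`. [folklore] -/
theorem tendsto_one_sub_exp_neg_div :
    Tendsto (fun t : ℝ ↦ (1 - Real.exp (-t)) / t) (𝓝[>] 0) (𝓝 1) := by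
  have h0 : HasDerivAt (fun t : ℝ ↦ 1 - Real.exp (-t)) (0 - Real.exp (-0) * (-1)) 0 :=
    (hasDerivAt_const (0 : ℝ) (1 : ℝ)).sub ((Real.hasDerivAt_exp (-0)).comp (0 : ℝ) ((hasDerivAt_id (0 : ℝ)).neg))
  have h1 := h0.tendsto_slope_zero_right
  simp only [neg_zero, Real.exp_zero, mul_neg, mul_one, sub_neg_eq_add, zero_add, smul_eq_mul] at h1
  refine h1.congr fun t ↦ ?_
  simp [div_eq_inv_mul]

/-- `F₃` is continuous at `0` from the right, with `F₃(0) = 0` (Mathlib conventions: `log 0 = 0`). [folklore] -/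
theorem continuousWithinAt_F3 :
    ContinuousWithinAt
      (fun v : ℝ ↦ Real.log (1 - Real.exp (-v)) - Real.log v + Real.log (v ^ 2 + 1) / 2) (Ici 0) 0 := by
  rw [← continuousWithinAt_Ioi_iff_Ici]
  unfold ContinuousWithinAt
  simp only [neg_zero, Real.exp_zero, sub_self, Real.log_zero, ne_eq, OfNat.ofNat_ne_zero,
    not_false_eq_true, zero_pow, zero_add, Real.log_one, zero_div, add_zero]
  -- on (0,∞): F₃(v) = log((1 − e^{-v})/v) + ½ log(v²+1)
  have h1 : Tendsto (fun v : ℝ ↦ Real.log ((1 - Real.exp (-v)) / v)) (𝓝[>] 0) (𝓝 0) := by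
    have := (Real.continuousAt_log one_ne_zero).tendsto.comp tendsto_one_sub_exp_neg_div
    rw [Real.log_one] at this
    exact this
  have h2 : Tendsto (fun v : ℝ ↦ Real.log (v ^ 2 + 1) / 2) (𝓝[>] 0) (𝓝 0) := by
    have hc : ContinuousAt (fun v : ℝ ↦ Real.log (v ^ 2 + 1) / 2) 0 :=
      ((continuousAt_id.pow 2).add continuousAt_const).log (by norm_num) |>.div_const 2
    have := hc.tendsto
    simp only [ne_eq, OfNat.ofNat_ne_zero, not_false_eq_true, zero_pow, zero_add, Real.log_one,
      zero_div] at this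
    exact this.mono_left nhdsWithin_le_nhds
  have h3 := h1.add h2
  rw [add_zero] at h3
  refine h3.congr' ?_
  filter_upwards [self_mem_nhdsWithin] with v (hv : 0 < v)
  have hex : 0 < 1 - Real.exp (-v) := by
    have : Real.exp (-v) < 1 := Real.exp_lt_one_iff.2 (by linarith)
    linarith
  rw [Real.log_div hex.ne' hv.ne']

/-- `F₃(v) → 0` as `v → ∞`. [folklore] -/
theorem tendsto_F3 :
    Tendsto (fun v : ℝ ↦ Real.log (1 - Real.exp (-v)) - Real.log v + Real.log (v ^ 2 + 1) / 2)
      atTop (𝓝 0) := by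
  -- log(1 − e^{-v}) → 0
  have h1 : Tendsto (fun v : ℝ ↦ Real.log (1 - Real.exp (-v))) atTop (𝓝 0) := by
    have ha : Tendsto (fun v : ℝ ↦ 1 - Real.exp (-v)) atTop (𝓝 (1 - 0)) :=
      tendsto_const_nhds.sub Real.tendsto_exp_neg_atTop_nhds_zero
    rw [sub_zero] at ha
    have := (Real.continuousAt_log one_ne_zero).tendsto.comp ha
    rw [Real.log_one] at this
    exact this
  -- −log v + ½ log(v²+1) = ½ log(1 + v⁻²) → 0
  have hq : Tendsto (fun v : ℝ ↦ v ^ 2) atTop atTop := tendsto_pow_atTop two_ne_zero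
  have h2a : Tendsto (fun v : ℝ ↦ 1 + 1 / v ^ 2) atTop (𝓝 (1 + 0)) :=
    tendsto_const_nhds.add (tendsto_const_nhds.div_atTop hq)
  rw [add_zero] at h2a
  have h2 : Tendsto (fun v : ℝ ↦ Real.log (1 + 1 / v ^ 2) / 2) atTop (𝓝 0) := by
    have := (Real.continuousAt_log one_ne_zero).tendsto.comp h2a
    rw [Real.log_one] at this
    simpa using this.div_const 2
  have h3 := h1.add h2
  rw [add_zero] at h3
  refine h3.congr' ?_
  filter_upwards [eventually_gt_atTop 0] with v hv
  have hv2 : (v ^ 2 : ℝ) ≠ 0 := by positivity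
  have : Real.log (1 + 1 / v ^ 2) = Real.log (v ^ 2 + 1) - 2 * Real.log v := by
    rw [show (1 : ℝ) + 1 / v ^ 2 = (v ^ 2 + 1) / v ^ 2 by field_simp,
      Real.log_div (by positivity) hv2, Real.log_pow]
    push_cast
    ring
  rw [this]
  ring

/-- `r` is measurable. [folklore] -/
theorem measurable_rFun : Measurable rFun := by
  unfold rFun; fun_prop

/-- `b₃ = r(v) + v/(v²+1)` is integrable on `(0, ∞)`: bounded on `(0,1]`, `≤ 2e^{−v} + v^{−3}` beyond.
[folklore] -/
theorem integrableOn_F3_deriv :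
    IntegrableOn (fun v : ℝ ↦ rFun v + v / (v ^ 2 + 1)) (Ioi 0) := by
  have hmeas : Measurable (fun v : ℝ ↦ rFun v + v / (v ^ 2 + 1)) :=
    measurable_rFun.add (by fun_prop)
  have h1 : IntegrableOn (fun v : ℝ ↦ rFun v + v / (v ^ 2 + 1)) (Ioc 0 1) := by
    refine Measure.integrableOn_of_bounded (M := 1 / 2 + 1) measure_Ioc_lt_top.ne
      hmeas.aestronglyMeasurable ?_
    rw [ae_restrict_iff' measurableSet_Ioc]
    refine ae_of_all _ fun v hv ↦ ?_
    have hr := abs_rFun_le hv.1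
    have hq : |v / (v ^ 2 + 1)| ≤ 1 := by
      rw [abs_of_nonneg (by have := hv.1.le; positivity)]
      rw [div_le_one (by positivity)]
      nlinarith [hv.1, hv.2]
    rw [Real.norm_eq_abs]
    exact (abs_add_le _ _).trans (add_le_add hr hq)
  have h2 : IntegrableOn (fun v : ℝ ↦ rFun v + v / (v ^ 2 + 1)) (Ioi 1) := by
    have hg1 : IntegrableOn (fun v : ℝ ↦ 2 * Real.exp (-1 * v)) (Ioi 1) :=
      (exp_neg_integrableOn_Ioi 1 zero_lt_one).const_mul 2
    have hg2 : IntegrableOn (fun v : ℝ ↦ v ^ (-3 : ℝ)) (Ioi 1) :=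
      integrableOn_Ioi_rpow_of_lt (by norm_num) zero_lt_one
    refine Integrable.mono' (hg1.add hg2) hmeas.aestronglyMeasurable ?_
    rw [ae_restrict_iff' measurableSet_Ioi]
    refine ae_of_all _ fun v (hv : 1 < v) ↦ ?_
    have hv0 : 0 < v := by linarith
    -- r(v) + v/(v²+1) = 1/(eᵛ−1) − 1/(v(v²+1))
    have hid : rFun v + v / (v ^ 2 + 1) = (Real.exp v - 1)⁻¹ - 1 / (v * (v ^ 2 + 1)) := by
      unfold rFun
      field_simp
      ring
    rw [Real.norm_eq_abs, hid]
    simp only [Pi.add_apply, neg_mul, one_mul]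
    have ha : |(Real.exp v - 1)⁻¹| ≤ 2 * Real.exp (-v) := by
      rw [abs_of_nonneg (inv_pos.2 ((sub_pos.2 (Real.one_lt_exp_iff.2 hv0)))).le]
      exact inv_exp_sub_one_le hv.le
    have hb : |1 / (v * (v ^ 2 + 1))| ≤ v ^ (-3 : ℝ) := by
      rw [abs_of_nonneg (by positivity), Real.rpow_neg hv0.le,
        show (3 : ℝ) = (3 : ℕ) by norm_num, Real.rpow_natCast, one_div]
      exact inv_anti₀ (by positivity) (by nlinarith)
    exact (abs_sub _ _).trans (add_le_add ha hb)
  have := h1.union h2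
  rwa [Ioc_union_Ioi_eq_Ioi zero_le_one] at this

/-- **`∫_0^∞ [r(v) + v/(v²+1)] dv = 0`** — the constant term of the corner weight vanishes
(«the `γ`'s cancel»). [folklore] -/
theorem integral_F3_deriv : ∫ v in Ioi (0 : ℝ), (rFun v + v / (v ^ 2 + 1)) = 0 := by
  rw [integral_Ioi_of_hasDerivAt_of_tendsto continuousWithinAt_F3 (fun v hv ↦ hasDerivAt_F3 hv)
    integrableOn_F3_deriv tendsto_F3]
  simp

/-! ## The corner weight: integral formula, sign, monotonicity, size -/

/-- Pointwise: `r(v + y/v) − r(v) = b₁(v) − b₂(v) − b₃(v)` for `v > 0`. [folklore] -/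
theorem rFun_shift_sub_eq {y v : ℝ} (hv : 0 < v) :
    rFun (v + y / v) - rFun v =
      (Real.exp (v + y / v) - 1)⁻¹ - (v / (v ^ 2 + y) - v / (v ^ 2 + 1)) -
        (rFun v + v / (v ^ 2 + 1)) := by
  unfold rFun
  have hv0 : v ≠ 0 := hv.ne'
  rcases eq_or_ne (v ^ 2 + y) 0 with h0 | h0
  · -- then v + y/v = 0 as well
    have : v + y / v = 0 := by
      field_simp
      linarith [h0]
    rw [this, h0]
    simp
  · have : (v + y / v)⁻¹ = v / (v ^ 2 + y) := by
      field_simp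
    rw [this]
    ring

/-- `v ↦ r(v + y/v) − r(v)` is integrable on `(0, ∞)` (`y > 0`). [folklore] -/
theorem integrableOn_rFun_shift_sub {y : ℝ} (hy : 0 < y) :
    IntegrableOn (fun v : ℝ ↦ rFun (v + y / v) - rFun v) (Ioi 0) := by
  have h := ((integrableOn_scriptW hy).sub (integrableOn_logQuad_deriv hy)).sub integrableOn_F3_deriv
  exact h.congr_fun (fun v hv ↦ (rFun_shift_sub_eq hv).symm) measurableSet_Ioi

/-- **`E(y) = ∫_0^∞ [r(v + y/v) − r(v)] dv`** (`y > 0`). [cite: KowalskiMichelVanderKam2000, Prop. 5.1 — derivation (real form of the corner weight)] -/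
theorem cornerE_eq_integral {y : ℝ} (hy : 0 < y) :
    cornerE y = ∫ v in Ioi (0 : ℝ), (rFun (v + y / v) - rFun v) := by
  have h1 := integrableOn_scriptW hy
  have h2 := integrableOn_logQuad_deriv hy
  have h3 := integrableOn_F3_deriv
  have h12 : IntegrableOn (fun v : ℝ ↦ (Real.exp (v + y / v) - 1)⁻¹ - (v / (v ^ 2 + y) - v / (v ^ 2 + 1)))
      (Ioi 0) := h1.sub h2
  rw [setIntegral_congr_fun measurableSet_Ioi (fun v hv ↦ rFun_shift_sub_eq (y := y) hv)]
  have e1 : ∫ v in Ioi (0 : ℝ), ((Real.exp (v + y / v) - 1)⁻¹ - (v / (v ^ 2 + y) - v / (v ^ 2 + 1)) -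
      (rFun v + v / (v ^ 2 + 1))) =
      (∫ v in Ioi (0 : ℝ), ((Real.exp (v + y / v) - 1)⁻¹ - (v / (v ^ 2 + y) - v / (v ^ 2 + 1)))) -
        ∫ v in Ioi (0 : ℝ), (rFun v + v / (v ^ 2 + 1)) := integral_sub h12 h3
  have e2 : ∫ v in Ioi (0 : ℝ), ((Real.exp (v + y / v) - 1)⁻¹ - (v / (v ^ 2 + y) - v / (v ^ 2 + 1))) =
      (∫ v in Ioi (0 : ℝ), (Real.exp (v + y / v) - 1)⁻¹) -
        ∫ v in Ioi (0 : ℝ), (v / (v ^ 2 + y) - v / (v ^ 2 + 1)) := integral_sub h1 h2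
  rw [e1, e2, integral_logQuad_deriv hy, integral_F3_deriv]
  unfold cornerE scriptW
  ring

/-- The integrand of `E` is non-negative. [folklore] -/
theorem rFun_shift_sub_nonneg {y v : ℝ} (hy : 0 ≤ y) (hv : 0 < v) : 0 ≤ rFun (v + y / v) - rFun v := by
  have h : v ≤ v + y / v := by have := div_nonneg hy hv.le; linarith
  have := monotoneOn_rFun (mem_Ioi.2 hv) (mem_Ioi.2 (phi_pos hy hv)) h
  linarith

/-- The integrand of `E` is monotone in `y`. [folklore] -/
theorem rFun_shift_sub_mono {y₁ y₂ v : ℝ} (hy₁ : 0 ≤ y₁) (h : y₁ ≤ y₂) (hv : 0 < v) :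
    rFun (v + y₁ / v) - rFun v ≤ rFun (v + y₂ / v) - rFun v := by
  have h' : v + y₁ / v ≤ v + y₂ / v := by
    have := div_le_div_of_nonneg_right h hv.le
    linarith
  have := monotoneOn_rFun (mem_Ioi.2 (phi_pos hy₁ hv)) (mem_Ioi.2 (phi_pos (hy₁.trans h) hv)) h'
  linarith

/-- **`E ≥ 0`.** [folklore] -/
theorem cornerE_nonneg {y : ℝ} (hy : 0 < y) : 0 ≤ cornerE y := by
  rw [cornerE_eq_integral hy]
  exact setIntegral_nonneg measurableSet_Ioi fun v hv ↦ rFun_shift_sub_nonneg hy.le hv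

/-- **`E` is monotone on `(0, ∞)`.** [folklore] -/
theorem cornerE_mono {y₁ y₂ : ℝ} (hy₁ : 0 < y₁) (h : y₁ ≤ y₂) : cornerE y₁ ≤ cornerE y₂ := by
  rw [cornerE_eq_integral hy₁, cornerE_eq_integral (hy₁.trans_le h)]
  exact setIntegral_mono_on (integrableOn_rFun_shift_sub hy₁)
    (integrableOn_rFun_shift_sub (hy₁.trans_le h)) measurableSet_Ioi
    fun v hv ↦ rFun_shift_sub_mono hy₁.le h hv

/-- An antiderivative of `r` on `(0, ∞)`: `R(v) = log(1 − e^{−v}) − log v`. [folklore] -/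
theorem hasDerivAt_R {v : ℝ} (hv : 0 < v) :
    HasDerivAt (fun v : ℝ ↦ Real.log (1 - Real.exp (-v)) - Real.log v) (rFun v) v := by
  have hex : 0 < 1 - Real.exp (-v) := by
    have : Real.exp (-v) < 1 := Real.exp_lt_one_iff.2 (by linarith)
    linarith
  have h0 : HasDerivAt (fun v : ℝ ↦ Real.exp (-v)) (Real.exp (-v) * (-1)) v :=
    (Real.hasDerivAt_exp (-v)).comp v ((hasDerivAt_id v).neg)
  have h1 : HasDerivAt (fun v : ℝ ↦ Real.log (1 - Real.exp (-v)))
      ((0 - Real.exp (-v) * (-1)) / (1 - Real.exp (-v))) v :=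
    ((hasDerivAt_const v (1 : ℝ)).sub h0).log hex.ne'
  have h2 : HasDerivAt (fun v : ℝ ↦ Real.log v) v⁻¹ v := Real.hasDerivAt_log hv.ne'
  refine (h1.sub h2).congr_deriv ?_
  unfold rFun
  rw [Real.exp_neg]
  have hne : (Real.exp v) ≠ 0 := (Real.exp_pos v).ne'
  have hpos : 0 < Real.exp v - 1 := (sub_pos.2 (Real.one_lt_exp_iff.2 hv))
  field_simp
  ring

/-- **The shift integral**: for `s > 0`, `∫_s^∞ [r(v+s) − r(v)] dv ≤ s/2` (it equals `R(s) − R(2s) =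
∫_s^{2s} (−r) ≤ s/2`), together with integrability. [folklore] -/
theorem integral_rFun_shift_le {s : ℝ} (hs : 0 < s) :
    IntegrableOn (fun v : ℝ ↦ rFun (v + s) - rFun v) (Ioi s) ∧
      ∫ v in Ioi s, (rFun (v + s) - rFun v) ≤ s / 2 := by
  set R : ℝ → ℝ := fun v ↦ Real.log (1 - Real.exp (-v)) - Real.log v with hR
  set G : ℝ → ℝ := fun v ↦ R (v + s) - R v with hG
  have hderiv : ∀ v ∈ Ici s, HasDerivAt G (rFun (v + s) - rFun v) v := by
    intro v hv
    have hv0 : 0 < v := hs.trans_le hv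
    have h1 : HasDerivAt (fun v : ℝ ↦ R (v + s)) (rFun (v + s) * 1) v :=
      (hasDerivAt_R (by linarith)).comp v ((hasDerivAt_id v).add_const s)
    rw [mul_one] at h1
    exact h1.sub (hasDerivAt_R hv0)
  have hnonneg : ∀ v ∈ Ioi s, 0 ≤ rFun (v + s) - rFun v := by
    intro v hv
    have hv0 : 0 < v := hs.trans hv
    have := monotoneOn_rFun (mem_Ioi.2 hv0) (mem_Ioi.2 (by linarith : 0 < v + s)) (by linarith)
    linarith
  -- G → 0 at ∞
  have hlim : Tendsto G atTop (𝓝 0) := by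
    have hA : Tendsto (fun v : ℝ ↦ Real.log (1 - Real.exp (-v))) atTop (𝓝 0) := by
      have ha : Tendsto (fun v : ℝ ↦ 1 - Real.exp (-v)) atTop (𝓝 (1 - 0)) :=
        tendsto_const_nhds.sub Real.tendsto_exp_neg_atTop_nhds_zero
      rw [sub_zero] at ha
      have := (Real.continuousAt_log one_ne_zero).tendsto.comp ha
      rw [Real.log_one] at this
      exact this
    have hA' : Tendsto (fun v : ℝ ↦ Real.log (1 - Real.exp (-(v + s)))) atTop (𝓝 0) :=
      hA.comp (tendsto_atTop_add_const_right _ s tendsto_id)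
    have hB : Tendsto (fun v : ℝ ↦ Real.log (1 + s / v)) atTop (𝓝 0) := by
      have hb : Tendsto (fun v : ℝ ↦ 1 + s / v) atTop (𝓝 (1 + 0)) :=
        tendsto_const_nhds.add (tendsto_const_nhds.div_atTop tendsto_id)
      rw [add_zero] at hb
      have := (Real.continuousAt_log one_ne_zero).tendsto.comp hb
      rw [Real.log_one] at this
      exact this
    have h := (hA'.sub hA).sub hB
    simp only [sub_zero] at h
    refine h.congr' ?_
    filter_upwards [eventually_gt_atTop 0] with v hv
    have : Real.log (1 + s / v) = Real.log (v + s) - Real.log v := by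
      rw [show (1 : ℝ) + s / v = (v + s) / v by field_simp, Real.log_div (by positivity) hv.ne']
    simp only [hG, hR, this]
    ring
  have hint : IntegrableOn (fun v : ℝ ↦ rFun (v + s) - rFun v) (Ioi s) :=
    integrableOn_Ioi_deriv_of_nonneg' hderiv hnonneg hlim
  refine ⟨hint, ?_⟩
  rw [integral_Ioi_of_hasDerivAt_of_tendsto' hderiv hint hlim]
  -- 0 − G(s) = R(s) − R(2s) = −∫_s^{2s} r ≤ s/2
  have hFTC : ∫ v in s..(2 * s), rFun v = R (2 * s) - R s := by
    refine intervalIntegral.integral_eq_sub_of_hasDerivAt (fun v hv ↦ hasDerivAt_R ?_) ?_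
    · rw [uIcc_of_le (by linarith)] at hv
      exact hs.trans_le hv.1
    · exact (continuousOn_rFun.mono fun v hv ↦ by
        rw [uIcc_of_le (by linarith)] at hv; exact hs.trans_le hv.1).intervalIntegrable
  have hlow : ∫ _ in s..(2 * s), (-(1 / 2) : ℝ) ≤ ∫ v in s..(2 * s), rFun v := by
    refine intervalIntegral.integral_mono_on (by linarith) intervalIntegrable_const ?_ ?_
    · exact (continuousOn_rFun.mono fun v hv ↦ by
        rw [uIcc_of_le (by linarith)] at hv; exact hs.trans_le hv.1).intervalIntegrable
    · intro v hv
      exact neg_half_le_rFun (hs.trans_le hv.1)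
  rw [intervalIntegral.integral_const, smul_eq_mul] at hlow
  have hGs : G s = R (2 * s) - R s := by simp only [hG]; ring_nf
  rw [hGs, ← hFTC]
  linarith

/-- **`E(y) ≤ √y`** (`y > 0`): on `(0, √y]` the integrand is `≤ −r ≤ ½`; on `(√y, ∞)` it is
`≤ r(v + √y) − r(v)` (as `y/v ≤ √y`), whose integral is `≤ √y/2`. [folklore] -/
theorem cornerE_le_sqrt {y : ℝ} (hy : 0 < y) : cornerE y ≤ Real.sqrt y := by
  set s := Real.sqrt y with hs_def
  have hs : 0 < s := Real.sqrt_pos.2 hy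
  have hsy : s * s = y := Real.mul_self_sqrt hy.le
  rw [cornerE_eq_integral hy]
  have hint := integrableOn_rFun_shift_sub hy
  have hsplit : Ioi (0 : ℝ) = Ioc 0 s ∪ Ioi s := (Ioc_union_Ioi_eq_Ioi hs.le).symm
  rw [hsplit, setIntegral_union (Set.Ioc_disjoint_Ioi le_rfl) measurableSet_Ioi
    (hint.mono_set Ioc_subset_Ioi_self) (hint.mono_set (Ioi_subset_Ioi hs.le))]
  -- first piece
  have h1 : ∫ v in Ioc 0 s, (rFun (v + y / v) - rFun v) ≤ ∫ _ in Ioc 0 s, (1 / 2 : ℝ) := by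
    refine setIntegral_mono_on (hint.mono_set Ioc_subset_Ioi_self) ?_ measurableSet_Ioc ?_
    · exact (integrableOn_const_iff (C := (1 / 2 : ℝ))).2 (Or.inr measure_Ioc_lt_top)
    · intro v hv
      have := rFun_nonpos (phi_pos hy.le hv.1)
      have := neg_half_le_rFun hv.1
      linarith
  have h1' : ∫ _ in Ioc 0 s, (1 / 2 : ℝ) = s / 2 := by
    rw [setIntegral_const, smul_eq_mul, Real.volume_real_Ioc, max_eq_left (by linarith)]
    ring
  -- second piece
  obtain ⟨hint2, hle2⟩ := integral_rFun_shift_le hs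
  have h2 : ∫ v in Ioi s, (rFun (v + y / v) - rFun v) ≤ ∫ v in Ioi s, (rFun (v + s) - rFun v) := by
    refine setIntegral_mono_on (hint.mono_set (Ioi_subset_Ioi hs.le)) hint2 measurableSet_Ioi ?_
    intro v (hv : s < v)
    have hv0 : 0 < v := hs.trans hv
    have hyv : y / v ≤ s := by
      rw [div_le_iff₀ hv0, ← hsy]
      exact mul_le_mul_of_nonneg_left hv.le hs.le
    have := monotoneOn_rFun (mem_Ioi.2 (phi_pos hy.le hv0)) (mem_Ioi.2 (by linarith : 0 < v + s))
      (by linarith)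
    linarith
  linarith

/-- **`E(y) ≤ 𝒲(1) + ½ log y` for `y ≥ 1`** (`𝒲` is decreasing). [folklore] -/
theorem cornerE_le_log {y : ℝ} (hy : 1 ≤ y) : cornerE y ≤ scriptW 1 + Real.log y / 2 := by
  unfold cornerE
  have := scriptW_anti one_pos hy
  linarith

end Summit.Parity.GeneralizedHardyLittlewood.Theorems.BeyondDiagonalBeatsQuarter.Corner
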